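import Summits.ValiantsHypothesis.ValiantsHypothesis.Theorems.DefinabilityGapPivotColumn
import Summits.ValiantsHypothesis.ValiantsHypothesis.Theorems.DefinabilityGapPrivateFree
import HarnessLib

/-!
# Definability gap, ROAD P: pivot collisions and movers — the first moment (N1 v2 §(5), round 1)

Clause 1 of `KIPivotFewBad` (injective pivots) fails at a curve `c` exactly when the pivot
column `s₀` is NOT free at the pivot row `r c`, i.e. some co-curve `c'` through the cell of
`c` at `(r c, s₀)` has `r c' = r c` (`not_free_iff_collides`).  This file bounds the number of
such COLLISIONS under a product law with marginals `≤ p`: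

* `collCount T s₀ r` — the number of ordered colliding pairs; every curve at which `s₀` is not
  free contributes at least one (`card_notFree_le_collCount`);
* **`sum_prodWeight_collCount_le`** — `E[collCount] ≤ p² Λ(s₀)` with
  `Λ(s₀) = Σ_{c ∈ T} colLoad T c s₀` (product rule for the two coordinates of a pair);
* `weight_filter_le_div` — Markov's inequality for finite weights;
* **`weight_manyCollisions_le`** — `W{K ≤ collCount} ≤ p² Λ(s₀) / K`.

With the pivot column of `exists_pivotColumn` (`m Λ ≤ 2 #T (#T − 1)`) and `p ≤ 2/m` this is
`E[#movers] = O(m)`: the alteration of PLAN-N1-v2 §(5) moves `O(m)` curves in round 1.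
-/

namespace Summit.ValiantsHypothesis.ValiantsHypothesis.Theorems.DefinabilityGapMovers

open Finset Real Literature.Probability.Moments
open Literature.Computability.AlgebraicComplexity Literature.Computability.MetaComplexity
open Summit.ValiantsHypothesis.ValiantsHypothesis.Theorems.DefinabilityGapAffineRung
open Summit.ValiantsHypothesis.ValiantsHypothesis.Theorems.DefinabilityGapPivotAdmissible
open Summit.ValiantsHypothesis.ValiantsHypothesis.Theorems.DefinabilityGapCrowdedFree
open Summit.ValiantsHypothesis.ValiantsHypothesis.Theorems.DefinabilityGapPivotColumn
open Summit.ValiantsHypothesis.ValiantsHypothesis.Theorems.DefinabilityGapBlockIndependence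
open Summit.ValiantsHypothesis.ValiantsHypothesis.Theorems.DefinabilityGapPrivateFree

/-! ## 1. Markov's inequality for finite weights -/

/-- **Markov**: `W{K ≤ f} ≤ E[f] / K` for nonnegative weights and functions. [this file] -/
theorem weight_filter_le_div {Ω : Type*} [Fintype Ω] (W f : Ω → ℝ) (hW : ∀ x, 0 ≤ W x)
    (hf : ∀ x, 0 ≤ f x) {K : ℝ} (hK : 0 < K) [DecidablePred fun x => K ≤ f x] :
    ∑ x ∈ univ.filter (fun x => K ≤ f x), W x ≤ (∑ x, W x * f x) / K := by
  rw [le_div_iff₀ hK, Finset.sum_mul]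
  calc ∑ x ∈ univ.filter (fun x => K ≤ f x), W x * K
      ≤ ∑ x ∈ univ.filter (fun x => K ≤ f x), W x * f x :=
        Finset.sum_le_sum fun x hx => mul_le_mul_of_nonneg_left (mem_filter.mp hx).2 (hW x)
    _ ≤ ∑ x, W x * f x :=
        Finset.sum_le_sum_of_subset_of_nonneg (filter_subset _ _)
          fun x _ _ => mul_nonneg (hW x) (hf x)

/-! ## 2. Collisions -/

variable {m : ℕ}

open scoped Classical in
/-- The number of ordered COLLIDING pairs for pivot column `s₀`: pairs `(c, c')` with `c ∈ T`,
`c'` a co-curve of `c` through its cell at `(r c, s₀)`, and `r c' = r c`. [this file] -/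
noncomputable def collCount (T : Finset (Fin 3 → Fin (qOf m))) (s₀ : Fin m)
    (r : (Fin 3 → Fin (qOf m)) → Fin m) : ℕ :=
  ∑ c ∈ T, ((coCurves T c (r c, s₀)).filter fun c' => r c' = r c).card

open scoped Classical in
/-- `s₀` is not free at the pivot row of `c` iff `c` collides with some co-curve. [this file] -/
theorem not_free_iff_collides (T : Finset (Fin 3 → Fin (qOf m))) (s₀ : Fin m)
    (r : (Fin 3 → Fin (qOf m)) → Fin m) (c : Fin 3 → Fin (qOf m)) :
    s₀ ∉ freeCols T c r (r c) ↔ ∃ c' ∈ coCurves T c (r c, s₀), r c' = r c := by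
  rw [mem_freeCols]
  push Not
  rfl

open scoped Classical in
/-- Every curve at which `s₀` is not free contributes a collision:
`#{c ∈ T : s₀ ∉ freeCols T c r (r c)} ≤ collCount T s₀ r`. [this file] -/
theorem card_notFree_le_collCount (T : Finset (Fin 3 → Fin (qOf m))) (s₀ : Fin m)
    (r : (Fin 3 → Fin (qOf m)) → Fin m) :
    (T.filter fun c => s₀ ∉ freeCols T c r (r c)).card ≤ collCount T s₀ r := by
  unfold collCount
  rw [Finset.card_eq_sum_ones, ← Finset.sum_filter_add_sum_filter_not T
    (fun c => s₀ ∉ freeCols T c r (r c))]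
  refine le_add_right (Finset.sum_le_sum fun c hc => ?_)
  obtain ⟨c', hc', hrc'⟩ := (not_free_iff_collides T s₀ r c).mp (mem_filter.mp hc).2
  exact Finset.card_pos.mpr ⟨c', mem_filter.mpr ⟨hc', hrc'⟩⟩

/-- The indicator of `r c = i`. [this file] -/
noncomputable def rowInd (c : Fin 3 → Fin (qOf m)) (i : Fin m)
    (r : (Fin 3 → Fin (qOf m)) → Fin m) : ℝ :=
  if r c = i then 1 else 0

/-- `rowInd` is nonnegative. [this file] -/
theorem rowInd_nonneg (c : Fin 3 → Fin (qOf m)) (i : Fin m)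
    (r : (Fin 3 → Fin (qOf m)) → Fin m) : 0 ≤ rowInd c i r := by
  unfold rowInd; split_ifs <;> norm_num

/-- `rowInd c i` depends only on coordinate `c`. [this file] -/
theorem dependsOn_rowInd (c : Fin 3 → Fin (qOf m)) (i : Fin m) :
    DependsOn (rowInd c i) (↑({c} : Finset (Fin 3 → Fin (qOf m))) : Set _) := by
  intro y z h
  unfold rowInd
  rw [h c (by simp)]

/-- `rowInd c' i` depends only on the complement of `{c}` when `c' ≠ c`. [this file] -/
theorem dependsOn_rowInd_compl {c c' : Fin 3 → Fin (qOf m)} (hc : c' ≠ c) (i : Fin m) :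
    DependsOn (rowInd c' i) ((↑({c} : Finset (Fin 3 → Fin (qOf m))) : Set _)ᶜ) := by
  intro y z h
  unfold rowInd
  rw [h c' (by simp [hc])]

/-- `E[rowInd c i] = w c i`. [this file] -/
theorem sum_prodWeight_mul_rowInd {w : (Fin 3 → Fin (qOf m)) → Fin m → ℝ}
    (hw1 : ∀ c, ∑ a, w c a = 1) (c : Fin 3 → Fin (qOf m)) (i : Fin m) :
    ∑ r : (Fin 3 → Fin (qOf m)) → Fin m, prodWeight w r * rowInd c i r = w c i := by
  unfold rowInd
  rw [sum_prodWeight_mul_coord hw1 c (fun a => if a = i then (1 : ℝ) else 0)]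
  simp [Finset.sum_ite_eq']

/-- `E[rowInd c i · rowInd c' i] = w c i · w c' i` for `c' ≠ c` (product rule). [this file] -/
theorem sum_prodWeight_mul_rowInd_mul {w : (Fin 3 → Fin (qOf m)) → Fin m → ℝ}
    (hw1 : ∀ c, ∑ a, w c a = 1) {c c' : Fin 3 → Fin (qOf m)} (hc : c' ≠ c) (i : Fin m) :
    ∑ r : (Fin 3 → Fin (qOf m)) → Fin m, prodWeight w r * (rowInd c i r * rowInd c' i r) =
      w c i * w c' i := by
  rw [sum_prodWeight_mul_mul_of_dependsOn hw1 {c} (dependsOn_rowInd c i)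
    (dependsOn_rowInd_compl hc i), sum_prodWeight_mul_rowInd hw1, sum_prodWeight_mul_rowInd hw1]

open scoped Classical in
/-- The collision count as a sum of pair indicators over `r`-INDEPENDENT index sets:
`collCount r = Σ_{c ∈ T} Σ_i Σ_{c' ∈ coCurves T c (i, s₀)} [r c = i] [r c' = i]`. [this file] -/
theorem collCount_eq_sum (T : Finset (Fin 3 → Fin (qOf m))) (s₀ : Fin m)
    (r : (Fin 3 → Fin (qOf m)) → Fin m) :
    (collCount T s₀ r : ℝ) =
      ∑ c ∈ T, ∑ i : Fin m, ∑ c' ∈ coCurves T c (i, s₀), rowInd c i r * rowInd c' i r := by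
  unfold collCount
  push_cast
  refine Finset.sum_congr rfl fun c _ => ?_
  have h : ∀ i : Fin m, ∑ c' ∈ coCurves T c (i, s₀), rowInd c i r * rowInd c' i r =
      if r c = i then ∑ c' ∈ coCurves T c (i, s₀), rowInd c' i r else 0 := by
    intro i
    unfold rowInd
    split_ifs with h
    · simp
    · simp
  simp_rw [h]
  rw [Finset.sum_ite_eq]
  simp only [Finset.mem_univ, if_true]
  rw [Finset.card_filter]
  push_cast
  refine Finset.sum_congr rfl fun c' _ => ?_
  unfold rowInd
  rfl

open scoped Classical in
/-- **FIRST MOMENT OF THE COLLISIONS**: under a product law with marginals `≤ p`,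
`E[collCount] ≤ p² · Σ_{c ∈ T} colLoad T c s₀`. [this file] -/
theorem sum_prodWeight_collCount_le {w : (Fin 3 → Fin (qOf m)) → Fin m → ℝ}
    (hw : ∀ c a, 0 ≤ w c a) (hw1 : ∀ c, ∑ a, w c a = 1) {p : ℝ} (hwp : ∀ c a, w c a ≤ p)
    (T : Finset (Fin 3 → Fin (qOf m))) (s₀ : Fin m) :
    ∑ r : (Fin 3 → Fin (qOf m)) → Fin m, prodWeight w r * collCount T s₀ r ≤
      p ^ 2 * ∑ c ∈ T, (colLoad T c s₀ : ℝ) := by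
  simp_rw [collCount_eq_sum, Finset.mul_sum]
  rw [Finset.sum_comm]
  refine Finset.sum_le_sum fun c _ => ?_
  rw [Finset.sum_comm]
  unfold colLoad
  push_cast
  rw [Finset.mul_sum]
  refine Finset.sum_le_sum fun i _ => ?_
  rw [Finset.sum_comm]
  calc ∑ c' ∈ coCurves T c (i, s₀), ∑ r, prodWeight w r * (rowInd c i r * rowInd c' i r)
      = ∑ c' ∈ coCurves T c (i, s₀), w c i * w c' i :=
        Finset.sum_congr rfl fun c' hc' =>
          sum_prodWeight_mul_rowInd_mul hw1 (mem_coCurves.mp hc').2.1 i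
    _ ≤ ∑ _c' ∈ coCurves T c (i, s₀), p ^ 2 :=
        Finset.sum_le_sum fun c' _ => by
          rw [sq]; exact mul_le_mul (hwp c i) (hwp c' i) (hw c' i) ((hw c i).trans (hwp c i))
    _ = p ^ 2 * ((coCurves T c (i, s₀)).card : ℝ) := by
        rw [Finset.sum_const, nsmul_eq_mul, mul_comm]

open scoped Classical in
/-- **MANY COLLISIONS ARE UNLIKELY** (Markov): `W{K ≤ collCount} ≤ p² Λ(s₀) / K`. [this file] -/
theorem weight_manyCollisions_le {w : (Fin 3 → Fin (qOf m)) → Fin m → ℝ}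
    (hw : ∀ c a, 0 ≤ w c a) (hw1 : ∀ c, ∑ a, w c a = 1) {p : ℝ} (hwp : ∀ c a, w c a ≤ p)
    (T : Finset (Fin 3 → Fin (qOf m))) (s₀ : Fin m) {K : ℝ} (hK : 0 < K) :
    ∑ r ∈ (Finset.univ : Finset ((Fin 3 → Fin (qOf m)) → Fin m)).filter
        (fun r => K ≤ (collCount T s₀ r : ℝ)), prodWeight w r ≤
      p ^ 2 * (∑ c ∈ T, (colLoad T c s₀ : ℝ)) / K :=
  (weight_filter_le_div (prodWeight w) (fun r => (collCount T s₀ r : ℝ)) (prodWeight_nonneg hw)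
    (fun _ => Nat.cast_nonneg _) hK).trans
    (div_le_div_of_nonneg_right (sum_prodWeight_collCount_le hw hw1 hwp T s₀) hK.le)

open scoped Classical in
/-- Off the many-collisions event, few curves have a non-free pivot column:
`collCount < K ⟹ #{c ∈ T : s₀ ∉ freeCols T c r (r c)} < K`. [this file] -/
theorem card_notFree_lt (T : Finset (Fin 3 → Fin (qOf m))) (s₀ : Fin m)
    (r : (Fin 3 → Fin (qOf m)) → Fin m) {K : ℝ} (h : ((collCount T s₀ r : ℕ) : ℝ) < K) :
    ((T.filter fun c => s₀ ∉ freeCols T c r (r c)).card : ℝ) < K :=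
  lt_of_le_of_lt (by exact_mod_cast card_notFree_le_collCount T s₀ r) h

/-- **The first-moment budget with the pivot column of `exists_pivotColumn`:**
`p² Λ(s₀) ≤ p² · 2 #T (#T − 1) / m`. [this file] -/
theorem sq_mul_load_le {p : ℝ} (T : Finset (Fin 3 → Fin (qOf m))) {s₀ : Fin m} (hm : 0 < m)
    (hs₀ : m * ∑ c ∈ T, colLoad T c s₀ ≤ 2 * (T.card * (T.card - 1))) :
    p ^ 2 * ∑ c ∈ T, (colLoad T c s₀ : ℝ) ≤
      p ^ 2 * (2 * ((T.card : ℝ) * (T.card - 1 : ℕ)) / m) := by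
  refine mul_le_mul_of_nonneg_left ?_ (sq_nonneg p)
  have hm' : (0 : ℝ) < m := by exact_mod_cast hm
  rw [le_div_iff₀ hm']
  have : ((m * ∑ c ∈ T, colLoad T c s₀ : ℕ) : ℝ) ≤ ((2 * (T.card * (T.card - 1)) : ℕ) : ℝ) := by
    exact_mod_cast hs₀
  push_cast at this
  linarith

end Summit.ValiantsHypothesis.ValiantsHypothesis.Theorems.DefinabilityGapMovers
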